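import Summits.HodgeConjecture.Ring2.RowFourTypeIOneSymplectic
import HarnessLib

/-!
# Ring 2 (cell topic `Summits/HodgeConjecture/Ring2/`; seat `lit`, gen 72, R49-F5): WHAT IS LEFT OF ROW I(1) IS EXACTLY THE MUMFORD POSITION — the two branches of the fourfold dichotomy exclude each other

HONEST FRAMING (cell `pub-hodge-ring2`, verbatim): research route conditional on HC_CM; not a corollary;
Q11.4-sentence-2 already refuted in dim ≥ 3. `HC_CM` does NOT occur in this file; no Markman here. Theorems only — no
definition, no named fact, no `sorry`. Conventions as in `RowFourTypeIOneSymplectic`: the instance hypothesis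
`[HodgeTensorFacts.{0, 0}]` (= the tree's theorem `hodgeTensorFacts_holds`) is a section binder and the real Hodge model is
the tree's theorem `exists_isReal_hodgeModel_holds`.

THE PRINT. B. Moonen, Yu. Zarhin, Math. Ann. **315** (1999), Thm. (0.1)(3) [held text `paper:arxiv-math_9901113` p. 1,
L112–118]: «Either `Hg(X) = Sp(V,φ)`, in which case `B•(Xⁿ) = D•(Xⁿ)` for all `n`, or `Hg(X)` is isogenous to a `ℚ`-form of
`SL₂ × SL₂ × SL₂`, in which case there are exceptional Hodge classes in `B²(X²)`» — an EXCLUSIVE disjunction.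

THIS FILE (sequel of `RowFourTypeIOneSymplectic`, whose §0 proves the dichotomy `hodgeLieC_sp_or_mumford_of_fourfold_endRankOne`
and whose §§1–2 remove the symplectic type I(1) fourfolds from the row-four residual). Input: the Literature lane's
`HodgeStructure.not_forall_skew_mem_hodgeLieC_of_raisingLine_rankEight` (`Motives/HodgeLieWeightOneRankEightSymplectic` §3:
a raising LINE `ℂ B₀` with `B₀ B̄₀ = μ₀ ≠ 0` on `V^{1,0}` is incompatible with `Hg = Sp`, by the rank-one `ψ_ℂ`-skew raising
operators `v ↦ ψ_ℂ(u, v) u`).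
* `not_exists_hodgeLieC_sp_of_raisingLine` — a fourfold whose `Lie Hg ⊗ ℂ` has a raising line with `B₀ C₀ = μ₀ ≠ 0` admits
  NO polarization `ψ` with `Lie Hg ⊗ ℂ ⊇ 𝔰𝔭(ψ_ℂ)`;
* **`not_exists_hodgeLieC_sp_iff_mumford_of_fourfold_endRankOne`** — for `finrank_ℚ End⁰(X) = 1`, `dim X = 4`: `X` is in the
  residual class of `RowFourTypeIOneSymplectic` §§1–2 IF AND ONLY IF `Lie Hg(H¹(X)) ⊗ ℂ` is in the Mumford position (data
  independent of `ψ`). So the type I(1) part of the row-four residual is EXACTLY the class of `End⁰ = ℚ` fourfolds in the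
  Mumford position (non-empty: Mumford 1969 §4; for them MZ99 prints `B•(X) = D•(X)` — not formalized — and
  `B²(X²) ≠ D²(X²)`).

## References
* [MoonenZarhin1999LowDim] B. Moonen, Yu. Zarhin, Math. Ann. 315 (1999), Thm. (0.1)(3), §2 (2.5)(1).
* [MoonenZarhin1995Duke] B. Moonen, Yu. Zarhin, Duke Math. J. 77 (1995), §2 (type I(1)).
* [Mumford1969NoteShimura] D. Mumford, Math. Ann. 181 (1969), §4.
-/

noncomputable section

open CategoryTheory CategoryTheory.Limits
open scoped TensorProduct

namespace Summit.HodgeConjecture.Ring2.RowFourTypeIOneMumford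

open Literature.AlgebraicGeometry.Motives (AbelianVariety bettiCohomology HodgeTensorFacts IsSmoothProjective)
open Literature.AlgebraicGeometry.Motives.AbelianVariety
open Literature.AlgebraicGeometry.Motives.HodgeStructure (not_forall_skew_mem_hodgeLieC_of_raisingLine_rankEight)
open Literature.AlgebraicGeometry.HodgeTheory
open Summit.HodgeConjecture.Ring2.RowFourTypeIOneSymplectic

variable [HodgeTensorFacts.{0, 0}] {X : AbelianVariety ℂ}

/-- **The Mumford position excludes `Hg = Sp` for an abelian FOURFOLD.** If the raising operators of `Lie Hg(H¹(X)) ⊗ ℂ`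
form a LINE `ℂ B₀` with `B₀ C₀ = μ₀ ≠ 0` on `H^{1,0}` (part of the Mumford data of
`hodgeLieC_sp_or_mumford_of_fourfold_endRankOne`), then NO polarization `ψ` of `H¹(X(ℂ); ℚ)` has all its `ψ_ℂ`-skew
operators in `Lie Hg ⊗ ℂ`, i.e. `X` is NOT in the class closed in §0: `dim_ℚ H¹ = 8`, `dim H^{1,0} = 4 ≥ 2`, and the
rank-one `ψ_ℂ`-skew raising operators `v ↦ ψ_ℂ(u, v) u` (`u ∈ H^{1,0}`) are not multiples of the surjective `B₀`
(`HodgeStructure.not_forall_skew_mem_hodgeLieC_of_raisingLine_rankEight`). [cite: MoonenZarhin1999LowDim, Thm. (0.1)(3)]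
[cite: Mumford1969NoteShimura, §4] -/
theorem not_exists_hodgeLieC_sp_of_raisingLine (h4 : X.dim = 4) {B₀ C₀ : Module.End ℂ (ℂ ⊗[ℚ] bettiCohomology X.X 1)}
    {μ₀ : ℂ} (hμ₀ : μ₀ ≠ 0)
    (hBC : ∀ p ∈ (BettiUniverse.hodge exists_isReal_hodgeModel_holds (isSmoothProjective_holds (A := X)) 1).piece 1 0,
      B₀ (C₀ p) = μ₀ • p)
    (hline : ∀ B' ∈ (BettiUniverse.hodge exists_isReal_hodgeModel_holds (isSmoothProjective_holds (A := X)) 1).hodgeLieC,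
      (∀ p ∈ (BettiUniverse.hodge exists_isReal_hodgeModel_holds (isSmoothProjective_holds (A := X)) 1).piece 1 0, B' p = 0) →
      (∀ v, B' v ∈ (BettiUniverse.hodge exists_isReal_hodgeModel_holds (isSmoothProjective_holds (A := X)) 1).piece 1 0) →
      ∃ c : ℂ, B' = c • B₀) :
    ¬ ∃ ψ : (BettiUniverse.hodge exists_isReal_hodgeModel_holds (isSmoothProjective_holds (A := X)) 1).Polarization,
      ∀ Y : Module.End ℂ (ℂ ⊗[ℚ] bettiCohomology X.X 1),
        (∀ x y, ψ.form.baseChange ℂ (Y x) y + ψ.form.baseChange ℂ x (Y y) = 0) →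
          Y ∈ (BettiUniverse.hodge exists_isReal_hodgeModel_holds (isSmoothProjective_holds (A := X)) 1).hodgeLieC := by
  rintro ⟨ψ, hsp⟩
  haveI : Module.Finite ℚ (bettiCohomology X.X 1) := finite_bettiCohomology_one X
  have hX : IsSmoothProjective X.dim X.X := isSmoothProjective_holds
  have heff := BettiUniverse.hodge_isEffective exists_isReal_hodgeModel_holds hX 1
  have hV : Module.finrank ℚ (bettiCohomology X.X 1) = 8 := by rw [finrank_bettiCohomology_one X, h4]
  exact not_forall_skew_mem_hodgeLieC_of_raisingLine_rankEight
    (BettiUniverse.hodge exists_isReal_hodgeModel_holds (isSmoothProjective_holds (A := X)) 1) Nat.cast_one heff ψ hV hμ₀ hBC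
    hline hsp

/-- **WHAT IS LEFT OF ROW I(1) IS EXACTLY THE ∃ Θ B₀ C₀ : Module.End ℂ (ℂ ⊗[ℚ] bettiCohomology X.X 1), ∃ μ₀ : ℂ,
      (∀ p, ∀ x ∈ (BettiUniverse.hodge exists_isReal_hodgeModel_holds (isSmoothProjective_holds (A := X)) 1).piece p (1 - p),
        Θ x = ((2 * p - 1 : ℤ) : ℂ) • x) ∧
      Θ ∈ (BettiUniverse.hodge exists_isReal_hodgeModel_holds (isSmoothProjective_holds (A := X)) 1).hodgeLieC ∧
      B₀ ∈ (BettiUniverse.hodge exists_isReal_hodgeModel_holds (isSmoothProjective_holds (A := X)) 1).hodgeLieC ∧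
      C₀ ∈ (BettiUniverse.hodge exists_isReal_hodgeModel_holds (isSmoothProjective_holds (A := X)) 1).hodgeLieC ∧ B₀ ≠ 0 ∧
      (∀ p ∈ (BettiUniverse.hodge exists_isReal_hodgeModel_holds (isSmoothProjective_holds (A := X)) 1).piece 1 0, B₀ p = 0) ∧
      (∀ v, B₀ v ∈ (BettiUniverse.hodge exists_isReal_hodgeModel_holds (isSmoothProjective_holds (A := X)) 1).piece 1 0) ∧
      (∀ v, C₀ v = Literature.AlgebraicGeometry.Motives.HodgeStructure.conj
        (B₀ (Literature.AlgebraicGeometry.Motives.HodgeStructure.conj v))) ∧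
      (∀ q ∈ (BettiUniverse.hodge exists_isReal_hodgeModel_holds (isSmoothProjective_holds (A := X)) 1).piece 0 1, C₀ q = 0) ∧
      (∀ v, C₀ v ∈ (BettiUniverse.hodge exists_isReal_hodgeModel_holds (isSmoothProjective_holds (A := X)) 1).piece 0 1) ∧
      μ₀ ≠ 0 ∧ starRingEnd ℂ μ₀ = μ₀ ∧
      (∀ p ∈ (BettiUniverse.hodge exists_isReal_hodgeModel_holds (isSmoothProjective_holds (A := X)) 1).piece 1 0,
        B₀ (C₀ p) = μ₀ • p) ∧
      (∀ q ∈ (BettiUniverse.hodge exists_isReal_hodgeModel_holds (isSmoothProjective_holds (A := X)) 1).piece 0 1,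
        C₀ (B₀ q) = μ₀ • q) ∧
      (∀ B' ∈ (BettiUniverse.hodge exists_isReal_hodgeModel_holds (isSmoothProjective_holds (A := X)) 1).hodgeLieC,
        (∀ p ∈ (BettiUniverse.hodge exists_isReal_hodgeModel_holds (isSmoothProjective_holds (A := X)) 1).piece 1 0,
          B' p = 0) →
        (∀ v, B' v ∈ (BettiUniverse.hodge exists_isReal_hodgeModel_holds (isSmoothProjective_holds (A := X)) 1).piece 1 0) →
        ∃ c : ℂ, B' = c • B₀) ∧
      (∀ C' ∈ (BettiUniverse.hodge exists_isReal_hodgeModel_holds (isSmoothProjective_holds (A := X)) 1).hodgeLieC,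
        (∀ q ∈ (BettiUniverse.hodge exists_isReal_hodgeModel_holds (isSmoothProjective_holds (A := X)) 1).piece 0 1,
          C' q = 0) →
        (∀ v, C' v ∈ (BettiUniverse.hodge exists_isReal_hodgeModel_holds (isSmoothProjective_holds (A := X)) 1).piece 0 1) →
        ∃ c : ℂ, C' = c • C₀) ∧
      ∃ W C : Submodule ℂ (Module.End ℂ (ℂ ⊗[ℚ] bettiCohomology X.X 1)),
        W ≤ (BettiUniverse.hodge exists_isReal_hodgeModel_holds (isSmoothProjective_holds (A := X)) 1).hodgeLieC ∧
        C ≤ (BettiUniverse.hodge exists_isReal_hodgeModel_holds (isSmoothProjective_holds (A := X)) 1).hodgeLieC ∧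
        W ⊓ C = ⊥ ∧
        W ⊔ C = (BettiUniverse.hodge exists_isReal_hodgeModel_holds (isSmoothProjective_holds (A := X)) 1).hodgeLieC ∧
        Module.finrank ℂ W = 3 ∧
        (∀ Y ∈ (BettiUniverse.hodge exists_isReal_hodgeModel_holds (isSmoothProjective_holds (A := X)) 1).hodgeLieC,
          ∀ w ∈ W, Y * w - w * Y ∈ W) ∧
        (∀ Y ∈ (BettiUniverse.hodge exists_isReal_hodgeModel_holds (isSmoothProjective_holds (A := X)) 1).hodgeLieC,
          ∀ c ∈ C, Y * c - c * Y ∈ C) ∧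
        (∀ w ∈ W, ∀ c ∈ C, w * c = c * w) ∧
        (∀ w ∈ W, ∀ s ∈ Submodule.span ℂ (Set.range ![B₀, C₀, Θ]), w * s = s * w)FORD POSITION.** For a complex abelian fourfold `X` with
`finrank_ℚ End⁰(X) = 1`: `X` belongs to the residual class of §§1–2 (NO polarization `ψ` with `Lie Hg ⊗ ℂ ⊇ 𝔰𝔭(ψ_ℂ)`) IF AND
ONLY IF `Lie Hg(H¹(X)) ⊗ ℂ` is in the Mumford position (the data of `hodgeLieC_sp_or_mumford_of_fourfold_endRankOne`, which
does not mention `ψ`; «`Hg(X)` is isogenous to a `ℚ`-form of `SL₂ × SL₂ × SL₂`, in which case there are exceptional Hodge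
classes in `B²(X²)`»). ⟹: a polarization exists (`smoothProjective_hodgeStructure_isPolarizable_holds`) and the dichotomy;
⟸: `not_exists_hodgeLieC_sp_of_raisingLine`. [cite: MoonenZarhin1999LowDim, Thm. (0.1)(3) and §2 (2.5)(1)]
[cite: MoonenZarhin1995Duke, §2 (type I(1))] [cite: Mumford1969NoteShimura, §4] -/
theorem not_exists_hodgeLieC_sp_iff_mumford_of_fourfold_endRankOne (h1 : Module.finrank ℚ X.endAlgebra = 1)
    (h4 : X.dim = 4) :
    (¬ ∃ ψ : (BettiUniverse.hodge exists_isReal_hodgeModel_holds (isSmoothProjective_holds (A := X)) 1).Polarization,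
      ∀ Y : Module.End ℂ (ℂ ⊗[ℚ] bettiCohomology X.X 1),
        (∀ x y, ψ.form.baseChange ℂ (Y x) y + ψ.form.baseChange ℂ x (Y y) = 0) →
          Y ∈ (BettiUniverse.hodge exists_isReal_hodgeModel_holds (isSmoothProjective_holds (A := X)) 1).hodgeLieC) ↔
    ∃ Θ B₀ C₀ : Module.End ℂ (ℂ ⊗[ℚ] bettiCohomology X.X 1), ∃ μ₀ : ℂ,
      (∀ p, ∀ x ∈ (BettiUniverse.hodge exists_isReal_hodgeModel_holds (isSmoothProjective_holds (A := X)) 1).piece p (1 - p),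
        Θ x = ((2 * p - 1 : ℤ) : ℂ) • x) ∧
      Θ ∈ (BettiUniverse.hodge exists_isReal_hodgeModel_holds (isSmoothProjective_holds (A := X)) 1).hodgeLieC ∧
      B₀ ∈ (BettiUniverse.hodge exists_isReal_hodgeModel_holds (isSmoothProjective_holds (A := X)) 1).hodgeLieC ∧
      C₀ ∈ (BettiUniverse.hodge exists_isReal_hodgeModel_holds (isSmoothProjective_holds (A := X)) 1).hodgeLieC ∧ B₀ ≠ 0 ∧
      (∀ p ∈ (BettiUniverse.hodge exists_isReal_hodgeModel_holds (isSmoothProjective_holds (A := X)) 1).piece 1 0, B₀ p = 0) ∧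
      (∀ v, B₀ v ∈ (BettiUniverse.hodge exists_isReal_hodgeModel_holds (isSmoothProjective_holds (A := X)) 1).piece 1 0) ∧
      (∀ v, C₀ v = Literature.AlgebraicGeometry.Motives.HodgeStructure.conj
        (B₀ (Literature.AlgebraicGeometry.Motives.HodgeStructure.conj v))) ∧
      (∀ q ∈ (BettiUniverse.hodge exists_isReal_hodgeModel_holds (isSmoothProjective_holds (A := X)) 1).piece 0 1, C₀ q = 0) ∧
      (∀ v, C₀ v ∈ (BettiUniverse.hodge exists_isReal_hodgeModel_holds (isSmoothProjective_holds (A := X)) 1).piece 0 1) ∧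
      μ₀ ≠ 0 ∧ starRingEnd ℂ μ₀ = μ₀ ∧
      (∀ p ∈ (BettiUniverse.hodge exists_isReal_hodgeModel_holds (isSmoothProjective_holds (A := X)) 1).piece 1 0,
        B₀ (C₀ p) = μ₀ • p) ∧
      (∀ q ∈ (BettiUniverse.hodge exists_isReal_hodgeModel_holds (isSmoothProjective_holds (A := X)) 1).piece 0 1,
        C₀ (B₀ q) = μ₀ • q) ∧
      (∀ B' ∈ (BettiUniverse.hodge exists_isReal_hodgeModel_holds (isSmoothProjective_holds (A := X)) 1).hodgeLieC,
        (∀ p ∈ (BettiUniverse.hodge exists_isReal_hodgeModel_holds (isSmoothProjective_holds (A := X)) 1).piece 1 0,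
          B' p = 0) →
        (∀ v, B' v ∈ (BettiUniverse.hodge exists_isReal_hodgeModel_holds (isSmoothProjective_holds (A := X)) 1).piece 1 0) →
        ∃ c : ℂ, B' = c • B₀) ∧
      (∀ C' ∈ (BettiUniverse.hodge exists_isReal_hodgeModel_holds (isSmoothProjective_holds (A := X)) 1).hodgeLieC,
        (∀ q ∈ (BettiUniverse.hodge exists_isReal_hodgeModel_holds (isSmoothProjective_holds (A := X)) 1).piece 0 1,
          C' q = 0) →
        (∀ v, C' v ∈ (BettiUniverse.hodge exists_isReal_hodgeModel_holds (isSmoothProjective_holds (A := X)) 1).piece 0 1) →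
        ∃ c : ℂ, C' = c • C₀) ∧
      ∃ W C : Submodule ℂ (Module.End ℂ (ℂ ⊗[ℚ] bettiCohomology X.X 1)),
        W ≤ (BettiUniverse.hodge exists_isReal_hodgeModel_holds (isSmoothProjective_holds (A := X)) 1).hodgeLieC ∧
        C ≤ (BettiUniverse.hodge exists_isReal_hodgeModel_holds (isSmoothProjective_holds (A := X)) 1).hodgeLieC ∧
        W ⊓ C = ⊥ ∧
        W ⊔ C = (BettiUniverse.hodge exists_isReal_hodgeModel_holds (isSmoothProjective_holds (A := X)) 1).hodgeLieC ∧
        Module.finrank ℂ W = 3 ∧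
        (∀ Y ∈ (BettiUniverse.hodge exists_isReal_hodgeModel_holds (isSmoothProjective_holds (A := X)) 1).hodgeLieC,
          ∀ w ∈ W, Y * w - w * Y ∈ W) ∧
        (∀ Y ∈ (BettiUniverse.hodge exists_isReal_hodgeModel_holds (isSmoothProjective_holds (A := X)) 1).hodgeLieC,
          ∀ c ∈ C, Y * c - c * Y ∈ C) ∧
        (∀ w ∈ W, ∀ c ∈ C, w * c = c * w) ∧
        (∀ w ∈ W, ∀ s ∈ Submodule.span ℂ (Set.range ![B₀, C₀, Θ]), w * s = s * w) := by
  constructor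
  · intro h
    haveI : Module.Finite ℚ (bettiCohomology X.X 1) := finite_bettiCohomology_one X
    have hX : IsSmoothProjective X.dim X.X := isSmoothProjective_holds
    obtain ⟨ψ⟩ : (BettiUniverse.hodge exists_isReal_hodgeModel_holds (isSmoothProjective_holds (A := X)) 1).IsPolarizable :=
      smoothProjective_hodgeStructure_isPolarizable_holds hX
        (BettiUniverse.realHodgeModel exists_isReal_hodgeModel_holds hX)
        (BettiUniverse.realHodgeModel_isHodgeSymmetric exists_isReal_hodgeModel_holds hX) 1
    rcases hodgeLieC_sp_or_mumford_of_fourfold_endRankOne h1 h4 ψ with hsp | hmum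
    · exact absurd ⟨ψ, hsp⟩ h
    · exact hmum
  · rintro ⟨Θ, B₀, C₀, μ₀, -, -, -, -, -, -, -, -, -, -, hμ₀, -, hBC, -, hline, -, -⟩
    exact not_exists_hodgeLieC_sp_of_raisingLine h4 hμ₀ hBC hline

end Summit.HodgeConjecture.Ring2.RowFourTypeIOneMumford

end
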